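import Summits.Ventures.Crystal3D.Theorems.StickyWulffConstantTextureLiminfTexShadowBilayerFrameRigidity
import HarnessLib

/-!
# TB-D assembly, part 5: LOCAL bilayer-frame rigidity — a bilayer PATCH of radius `1` determines the frame lattice
# (lane T, crux `TextureLiminfV5`, stmt-Ventures-23912; design memo TB-D-0 §8 (F4) «(A-rig)»)

HONEST FRAMING. Venture `Summits/Ventures/Crystal3D` (cell `crystal3d-full`), route `route-Ventures-StickyWulffConstant`, helper `--supports` the
law-v5 crux `TextureLiminfV5` (stmt-Ventures-23912).  Pure lattice geometry (census-free, standard axioms); the local form of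
`image_fccRef_eq_of_bilayer_subset` (…TexShadowBilayerFrameRigidity, which needs the WHOLE bilayer); F-C1 not moved.

WHY.  In the texture assembly two slab grains in AGREEMENT contact (`Mesh₃.hagree` & co.: the two grains' stackings coincide on a ball) must
carry frames with the SAME linear lattice, so that the law (`IsTexture`) lets the wall charge be `0` there.  The frames are bilayer frames of
two different grains; all one knows is that the two bilayers share a patch.  A patch of radius `1` around one bilayer point suffices: its
differences already contain the twelve unit vectors of the frame lattice.
* `unitVec_subset_sub_local` — every unit vector of `fccRef` is a difference of two points of the reference bilayer `B₀` within distance `1`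
  of any given point of `B₀`;
* **`image_fccRef_eq_of_bilayer_patch_subset`** — if the points of `bilayer L s σ i` within distance `1` of one of its points lie in the affine
  lattices `(A· + u) '' fccRef` and `(A'· + u') '' fccRef`, then `A '' fccRef = A' '' fccRef`.
-/

noncomputable section

namespace Summit.Ventures.Crystal3D.TentCertificate

open Summit.Ventures.Crystal3D
open Literature.MathematicalPhysics.StatisticalMechanics (fccStacking barlowStacking barlowPos barlowLayer constHagg
  IsHaggSeq barlowPos_mem exists_motion_fccBilayer_zero_eq_moved)
open Summit.Ventures.Crystal3D.Cruxes.TextureLiminf.TexShadow (fccRef stacking bilayer)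
open scoped InnerProductSpace

/-- **Local differences.**  For every point `b₀ = toRef (site n₀)` of the reference bilayer `B₀` (layers `0, 1`), every unit vector of
`fccRef` is a difference of two points of `B₀` within distance `1` of `b₀`. -/
theorem unitVec_subset_sub_local {n₀ : Site} (hn₀ : layer n₀ = 0 ∨ layer n₀ = 1) :
    unitVec ⊆ {w | ∃ b ∈ toRef '' (site '' {n | layer n = 0 ∨ layer n = 1}) ∩ Metric.closedBall (toRef (site n₀)) 1,
      ∃ b' ∈ toRef '' (site '' {n | layer n = 0 ∨ layer n = 1}) ∩ Metric.closedBall (toRef (site n₀)) 1, w = b - b'} := by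
  rw [unitVec_eq_image]
  rintro _ ⟨δ, hδ, rfl⟩
  have hlay : ∀ d ∈ fccOffsets, layer d = 1 ∨ layer d = 0 ∨ layer d = -1 := by decide
  have hb₀ : toRef (site n₀) ∈ toRef '' (site '' {n | layer n = 0 ∨ layer n = 1}) ∩ Metric.closedBall (toRef (site n₀)) 1 :=
    ⟨⟨_, ⟨n₀, hn₀, rfl⟩, rfl⟩, Metric.mem_closedBall_self zero_le_one⟩
  have hnorm : ‖toRef (site δ)‖ = 1 := (toRef_site_mem_unitVec hδ).2
  have hadd : toRef (site (n₀ + δ)) - toRef (site n₀) = toRef (site δ) := by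
    rw [← map_sub, ← site_sub, add_sub_cancel_left]
  have hsub' : toRef (site n₀) - toRef (site (n₀ - δ)) = toRef (site δ) := by
    rw [← map_sub, ← site_sub, sub_sub_cancel]
  have h1 : layer (n₀ + δ) = layer n₀ + layer δ := by simp only [layer, Pi.add_apply]; ring
  have h2 : layer (n₀ - δ) = layer n₀ - layer δ := by simp only [layer, Pi.sub_apply]; ring
  by_cases hplus : layer (n₀ + δ) = 0 ∨ layer (n₀ + δ) = 1
  · refine ⟨toRef (site (n₀ + δ)), ⟨⟨_, ⟨n₀ + δ, hplus, rfl⟩, rfl⟩, ?_⟩, toRef (site n₀), hb₀, hadd.symm⟩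
    rw [Metric.mem_closedBall, dist_eq_norm, hadd, hnorm]
  · have hminus : layer (n₀ - δ) = 0 ∨ layer (n₀ - δ) = 1 := by
      rw [h1] at hplus
      rw [h2]
      rcases hn₀ with h | h <;> rcases hlay δ hδ with h' | h' | h' <;> omega
    refine ⟨toRef (site n₀), hb₀, toRef (site (n₀ - δ)), ⟨⟨_, ⟨n₀ - δ, hminus, rfl⟩, rfl⟩, ?_⟩, hsub'.symm⟩
    rw [Metric.mem_closedBall, dist_eq_norm, ← neg_sub, norm_neg, hsub', hnorm]

/-- **Local bilayer-frame rigidity.**  If the points of the bilayer `bilayer L s σ i` within distance `1` of one of its points `x₀` lie in two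
affine lattices `(A· + u) '' fccRef` and `(A'· + u') '' fccRef`, then the two linear lattices agree: `A '' fccRef = A' '' fccRef`. -/
theorem image_fccRef_eq_of_bilayer_patch_subset {σ : ℤ → ℤ} (hσ : IsHaggSeq σ) (L : E3 ≃ₗᵢ[ℝ] E3) (s : E3) (i : ℤ)
    {x₀ : E3} (hx₀ : x₀ ∈ bilayer L s σ i) {A A' : E3 ≃ₗᵢ[ℝ] E3} {u u' : E3}
    (hA : bilayer L s σ i ∩ Metric.closedBall x₀ 1 ⊆ (fun r => A r + u) '' fccRef)
    (hA' : bilayer L s σ i ∩ Metric.closedBall x₀ 1 ⊆ (fun r => A' r + u') '' fccRef) :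
    A '' fccRef = A' '' fccRef := by
  obtain ⟨M, c, hlay, -⟩ := exists_motion_fccBilayer_zero_eq_moved 1 hB hσ L s i
  have hbil := bilayer_eq_image L s σ i
  -- `x₀ = M b₀ + c` for a site point `b₀` of the reference bilayer
  have hx₀' : x₀ ∈ (fun r => M r + c) '' (barlowLayer 1 hB constHagg 0 ∪ barlowLayer 1 hB constHagg 1) := by
    rw [hlay, ← hbil]; exact hx₀
  obtain ⟨r₀, hr₀, hx₀e⟩ := hx₀'
  obtain ⟨n₀, hn₀, hr₀e⟩ : ∃ n₀ : Site, (layer n₀ = 0 ∨ layer n₀ = 1) ∧ toRef (site n₀) = r₀ := by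
    rcases hr₀ with h | h
    · obtain ⟨n, hn, he⟩ := exists_site_of_mem_barlowLayer h; exact ⟨n, Or.inl hn, he⟩
    · obtain ⟨n, hn, he⟩ := exists_site_of_mem_barlowLayer h; exact ⟨n, Or.inr hn, he⟩
  -- the local reference patch moved by `(M, c)` lies in the bilayer patch, hence in both affine lattices
  set B : Set E3 := toRef '' (site '' {n | layer n = 0 ∨ layer n = 1}) ∩ Metric.closedBall (toRef (site n₀)) 1 with hBdef
  have hB₀ : ∀ (A₀ : E3 ≃ₗᵢ[ℝ] E3) (u₀ : E3), bilayer L s σ i ∩ Metric.closedBall x₀ 1 ⊆ (fun r => A₀ r + u₀) '' fccRef →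
      (fun r => M r + c) '' B ⊆ (fun r => A₀ r + u₀) '' fccRef := by
    intro A₀ u₀ h₀
    rintro _ ⟨b, ⟨⟨_, ⟨n, hn, rfl⟩, rfl⟩, hbd⟩, rfl⟩
    refine h₀ ⟨?_, ?_⟩
    · rw [hbil, ← hlay]
      refine ⟨toRef (site n), ?_, rfl⟩
      have h := toRef_site_mem_barlowLayer n
      rcases hn with hn | hn
      · left; rwa [hn] at h
      · right; rw [hn] at h; simpa using h
    · rw [Metric.mem_closedBall, ← hx₀e, ← hr₀e]
      show dist (M (toRef (site n)) + c) (M (toRef (site n₀)) + c) ≤ 1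
      rw [dist_add_right, LinearIsometryEquiv.dist_map]
      exact hbd
  have bij := mapsTo_unitVec_of_subset (hB₀ A u hA) (unitVec_subset_sub_local hn₀)
  have bij' := mapsTo_unitVec_of_subset (hB₀ A' u' hA') (unitVec_subset_sub_local hn₀)
  have key : ∀ (A₁ A₂ : E3 ≃ₗᵢ[ℝ] E3), Set.BijOn (fun w => A₁.symm (M w)) unitVec unitVec →
      Set.BijOn (fun w => A₂.symm (M w)) unitVec unitVec → ∀ w ∈ unitVec, A₁ w ∈ A₂ '' fccRef := by
    intro A₁ A₂ h₁ h₂ w hw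
    obtain ⟨w₁, hw₁, hw₁e⟩ := h₁.surjOn hw
    have hm : A₂.symm (M w₁) ∈ unitVec := h₂.mapsTo hw₁
    refine ⟨A₂.symm (M w₁), hm.1, ?_⟩
    simp only at hw₁e
    rw [LinearIsometryEquiv.apply_symm_apply, ← hw₁e, LinearIsometryEquiv.apply_symm_apply]
  exact Set.Subset.antisymm (image_fccRef_subset_of_unitVec (key A A' bij bij'))
    (image_fccRef_subset_of_unitVec (key A' A bij' bij))

end Summit.Ventures.Crystal3D.TentCertificate

end
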